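import Literature.Probability.NegativeDependence.NegativeAssociationHierarchy
import HarnessLib

/-!
# Negative association is decided on increasing events (Borcea–Brändén–Liggett §2.1, §4.2)

J. Borcea, P. Brändén, T. M. Liggett, *Negative dependence and the geometry of polynomials*, J. Amer. Math. Soc.
22 (2009) 521–567 (arXiv:0707.2340, held `paper:arxiv-0707.2340`). Verbatim, §2.1 (p. 6):

> An increasing event `𝒜` on `2^{[n]}` is a collection of subsets of `[n]` that is closed upwards under
> containment […]. Any (non-identically zero) non-negative increasing function `f` on `2^{[n]}` may be written as
> `f = Σ_{i=1}^k a_i χ_{𝒜_i}` for some increasing events `𝒜_i` on `2^{[n]}` and `a_i > 0`, `1 ≤ i ≤ k`. Clearly, `f`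
> depends on the set `ℐ(f) := ℐ(𝒜_1) ∪ ⋯ ∪ ℐ(𝒜_k)`.

and §4.2 (p. 16, sketch of the proof of Theorem 4.8):

> Since any increasing function depending on a set `E_0` can be written as a positive linear combination of
> characteristic functions, `χ_𝒜`, of increasing events `𝒜` depending on `E_0`, it is enough to prove the theorem
> for such characteristic functions.

and §6 (p. 25, proof of Theorem 6.4):

> Furthermore, it is enough to prove this in case when the `g_k`'s and `h_k`'s take only the values `0` and `1`,
> since any increasing function on a partially ordered set (in this case, `{0,…,n} × {0,1}`) can be written as a
> positive linear combination of increasing functions that take only the values `0` and `1`.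

## What is here

* §1 **The finite layer cake in functional form** (`sum_mul_nonneg_of_upperSets`): on a finite preorder, a signed
  kernel `κ` of total mass `0` that is nonnegative on every up-set pairs nonnegatively with every increasing
  function — the form in which "it is enough to prove the theorem for characteristic functions" is used for a
  bilinear inequality; from the tree's `exists_upperSet_decomposition` (`Sahi2008/Indicators.lean`).
* §2 **NA is decided on increasing events** (`ex_mul_mass_le_of_upperSets`, one factor at a time, respecting
  "depending on `E_0`"; **`isNegAssoc_of_events`**, **`isNegAssoc_iff_events`**): the tree's `IsNegAssoc` (BBL
  Def. 2.7, increasing *functions* on disjoint coordinate sets) holds as soon as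
  `μ(𝒜 ∩ ℬ) μ(Ω) ≤ μ(𝒜) μ(ℬ)` for increasing *events* `𝒜`, `ℬ` depending on disjoint coordinate sets; and the same
  for CNA (`isCNA_of_events`).

## References

* [BorceaBrandenLiggett2007] J. Borcea, P. Brändén, T. M. Liggett, Negative dependence and the geometry of
  polynomials, J. Amer. Math. Soc. 22 (2009); arXiv:0707.2340 — §2.1 (increasing events, layer cake), Def. 2.7;
  §4.2 (proof sketch of Thm. 4.8); §6 proof of Thm. 6.4 (0/1 reduction).
* [LiebSahi2021] E. H. Lieb, S. Sahi, Lemma 2.2 (finite layer cake; the tree's `exists_upperSet_decomposition`).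
* [Pemantle2000] R. Pemantle, Towards a theory of negative dependence, J. Math. Phys. 41 (2000) — §2.2 Def. 2.1.
-/

noncomputable section

open Finset
open Literature.Combinatorics.Sahi2008

universe u

namespace Literature.Probability.NegativeDependence

/-! ## §1 The finite layer cake in functional form -/

section LayerCake

variable {α : Type*} [Fintype α] [DecidableEq α]

/-- `Σ_x χ_A(x) κ(x) = Σ_{x ∈ A} κ(x)`. [cite: BorceaBrandenLiggett2007, §2.1 (characteristic functions `χ_𝒜`)] -/
theorem sum_setInd_mul (A : Finset α) (κ : α → ℝ) : ∑ x, setInd A x * κ x = ∑ x ∈ A, κ x := by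
  simp only [setInd_apply, ite_mul, one_mul, zero_mul]
  rw [Finset.sum_ite_mem, Finset.univ_inter]

/-- Pairing a layer-cake sum `Σ_k c_k χ_{U_k}` with a kernel. [cite: BorceaBrandenLiggett2007, §2.1
(`f = Σ a_i χ_{𝒜_i}`)] -/
theorem sum_listSum_smul_setInd_mul (κ : α → ℝ) (l : List (ℝ × Finset α)) :
    ∑ x, (l.map fun p => p.1 • setInd p.2).sum x * κ x = (l.map fun p => p.1 * ∑ x ∈ p.2, κ x).sum := by
  induction l with
  | nil => simp
  | cons p l ih =>
    rw [List.map_cons, List.sum_cons, List.map_cons, List.sum_cons, ← ih, ← sum_setInd_mul p.2 κ, Finset.mul_sum,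
      ← Finset.sum_add_distrib]
    refine Finset.sum_congr rfl fun x _ => ?_
    rw [Pi.add_apply, Pi.smul_apply, smul_eq_mul]
    ring

/-- **The finite layer cake, functional form.** On a finite preorder, if a kernel `κ` has total mass `0` and
nonnegative mass on every up-set, then `Σ_x f(x) κ(x) ≥ 0` for every increasing `f` ("any increasing function on
a partially ordered set can be written as a positive linear combination of increasing functions that take only
the values `0` and `1`", applied to `f - min f`). [cite: BorceaBrandenLiggett2007, §6 proof of Thm. 6.4 (0/1
reduction); §2.1 (`f = Σ a_i χ_{𝒜_i}`); LiebSahi2021, Lemma 2.2] -/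
theorem sum_mul_nonneg_of_upperSets [Preorder α] (κ : α → ℝ) (h0 : ∑ x, κ x = 0)
    (hU : ∀ U : Finset α, IsUpperSet (U : Set α) → 0 ≤ ∑ x ∈ U, κ x) {f : α → ℝ} (hf : Monotone f) :
    0 ≤ ∑ x, f x * κ x := by
  rcases isEmpty_or_nonempty α with hα | hα
  · simp
  set m : ℝ := Finset.univ.inf' Finset.univ_nonempty f with hm
  have hmle : ∀ x, m ≤ f x := fun x => Finset.inf'_le f (Finset.mem_univ x)
  set f' : α → ℝ := fun x => f x - m with hf'
  have hf'0 : ∀ x, 0 ≤ f' x := fun x => sub_nonneg.2 (hmle x)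
  have hf'm : Monotone f' := fun x y hxy => sub_le_sub_right (hf hxy) m
  obtain ⟨l, hl, hfl⟩ := exists_upperSet_decomposition f' hf'0 hf'm
  have hsplit : ∑ x, f x * κ x = ∑ x, f' x * κ x + m * ∑ x, κ x := by
    rw [Finset.mul_sum, ← Finset.sum_add_distrib]
    exact Finset.sum_congr rfl fun x _ => by simp only [hf']; ring
  rw [hsplit, h0, mul_zero, add_zero, hfl, sum_listSum_smul_setInd_mul]
  refine List.sum_nonneg fun x hx => ?_
  obtain ⟨p, hp, rfl⟩ := List.mem_map.1 hx
  exact mul_nonneg (hl p hp).1 (hU p.2 (hl p hp).2)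

end LayerCake

/-! ## §2 Negative association is decided on increasing events -/

section Events

variable {σ : Type u} [Fintype σ] [DecidableEq σ]

/-- `∫ χ_𝒜 dμ = μ(𝒜)`. [cite: BorceaBrandenLiggett2007, §2.1 (characteristic functions `χ_𝒜`)] -/
theorem ex_setInd (μ : Finset σ → ℝ) (𝒜 : Finset (Finset σ)) : ex μ (setInd 𝒜) = ∑ S ∈ 𝒜, μ S := by
  simp only [ex_def, setInd_apply, mul_ite, mul_one, mul_zero]
  rw [Finset.sum_ite_mem, Finset.univ_inter]

omit [DecidableEq σ] in
/-- The bilinear NA defect `∫F dμ ∫H dμ - ∫FH dμ · μ(Ω)` as the pairing of `H` with the kernel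
`κ₀(S) = μ(S) (∫F dμ - F(S) μ(Ω))`. [cite: BorceaBrandenLiggett2007, §2.1 Def. 2.7; §6 proof of Thm. 6.4 (the
covariance written as a double sum)] -/
theorem sum_mul_naKernel (μ F H : Finset σ → ℝ) :
    ∑ S, H S * (μ S * ex μ F - μ S * F S * mass μ) = ex μ F * ex μ H - ex μ (F * H) * mass μ := by
  rw [ex_def μ H, ex_def μ (F * H), Finset.mul_sum, Finset.sum_mul, ← Finset.sum_sub_distrib]
  exact Finset.sum_congr rfl fun S _ => by simp only [Pi.mul_apply]; ring

/-- Pushing the kernel forward along `S ↦ S ∩ E`: `Σ_B H(B) Σ_{S ∩ E = B} κ₀(S) = Σ_S H(S ∩ E) κ₀(S)`.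
[cite: BorceaBrandenLiggett2007, §2.1 ("such an event depends only on the set `ℐ(𝒜)`")] -/
theorem sum_mul_sum_fiber_inter (E : Finset σ) (H κ₀ : Finset σ → ℝ) :
    ∑ B, H B * (∑ S with S ∩ E = B, κ₀ S) = ∑ S, H (S ∩ E) * κ₀ S := by
  calc ∑ B, H B * (∑ S with S ∩ E = B, κ₀ S) = ∑ B, ∑ S with S ∩ E = B, H (S ∩ E) * κ₀ S := by
        refine Finset.sum_congr rfl fun B _ => ?_
        rw [Finset.mul_sum]
        refine Finset.sum_congr rfl fun S hS => ?_
        rw [(Finset.mem_filter.1 hS).2]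
    _ = ∑ S, H (S ∩ E) * κ₀ S := Finset.sum_fiberwise Finset.univ (fun S => S ∩ E) (fun S => H (S ∩ E) * κ₀ S)

/-- **One factor at a time**: if the NA inequality `∫FH dμ · μ(Ω) ≤ ∫F dμ ∫H dμ` holds for a fixed `F` and every
characteristic function `H = χ_ℬ` of an increasing event `ℬ` depending on `E`, then it holds for `F` and every
increasing `G` depending on `E` ("it is enough to prove the theorem for such characteristic functions").
[cite: BorceaBrandenLiggett2007, §4.2 (proof sketch of Thm. 4.8); §2.1 (layer cake, Def. 2.7)] -/
theorem ex_mul_mass_le_of_upperSets {μ : Finset σ → ℝ} {F : Finset σ → ℝ} {E : Finset σ}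
    (h : ∀ ℬ : Finset (Finset σ), IsUpperSet (ℬ : Set (Finset σ)) → DeterminedBy (setInd ℬ) E →
      ex μ (F * setInd ℬ) * mass μ ≤ ex μ F * ex μ (setInd ℬ))
    {G : Finset σ → ℝ} (hG : Monotone G) (hGE : DeterminedBy G E) :
    ex μ (F * G) * mass μ ≤ ex μ F * ex μ G := by
  -- the kernel, pushed forward along `S ↦ S ∩ E`
  set κ₀ : Finset σ → ℝ := fun S => μ S * ex μ F - μ S * F S * mass μ with hκ₀
  set κ : Finset σ → ℝ := fun B => ∑ S with S ∩ E = B, κ₀ S with hκ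
  have pair : ∀ H : Finset σ → ℝ, ∑ B, H B * κ B = ∑ S, H (S ∩ E) * κ₀ S := fun H =>
    sum_mul_sum_fiber_inter E H κ₀
  -- total mass `0`
  have h0 : ∑ B, κ B = 0 := by
    have hm : ex μ (fun _ => (1 : ℝ)) = mass μ := by simp [ex_def, mass_def]
    have hm' : ex μ (F * fun _ => (1 : ℝ)) = ex μ F := by simp [ex_def]
    have h2 := sum_mul_naKernel μ F fun _ => (1 : ℝ)
    rw [hm, hm'] at h2
    rw [show (∑ B, κ B) = ∑ B, (fun _ => (1 : ℝ)) B * κ B by simp, pair]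
    simp only [hκ₀, one_mul] at h2 ⊢
    rw [h2]
    ring
  -- nonnegative on up-sets: the event `{S : S ∩ E ∈ 𝒰}` is increasing and depends on `E`
  have hU : ∀ 𝒰 : Finset (Finset σ), IsUpperSet (𝒰 : Set (Finset σ)) → 0 ≤ ∑ B ∈ 𝒰, κ B := by
    intro 𝒰 h𝒰
    set ℬ : Finset (Finset σ) := Finset.univ.filter fun S => S ∩ E ∈ 𝒰 with hℬ
    have hℬup : IsUpperSet (ℬ : Set (Finset σ)) := by
      intro S T hST hS
      rw [Finset.mem_coe, hℬ, Finset.mem_filter] at hS ⊢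
      exact ⟨Finset.mem_univ _, h𝒰 (Finset.inter_subset_inter hST (subset_refl E)) hS.2⟩
    have hℬE : DeterminedBy (setInd ℬ) E := fun S T hST => by
      simp only [setInd_apply, hℬ, Finset.mem_filter, Finset.mem_univ, true_and, hST]
    have hind : ∀ S, setInd 𝒰 (S ∩ E) = setInd ℬ S := fun S => by
      simp only [setInd_apply, hℬ, Finset.mem_filter, Finset.mem_univ, true_and]
    rw [← sum_setInd_mul, pair, Finset.sum_congr rfl fun S _ => by rw [hind S], hκ₀, sum_mul_naKernel]
    exact sub_nonneg.2 (h ℬ hℬup hℬE)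
  -- the layer cake
  have key := sum_mul_nonneg_of_upperSets κ h0 hU hG
  rw [pair, Finset.sum_congr rfl fun S _ => by
      rw [show G (S ∩ E) = G S from hGE _ _ (by rw [Finset.inter_assoc, Finset.inter_self])],
    hκ₀, sum_mul_naKernel] at key
  exact sub_nonneg.1 key

/-- **Negative association is decided on increasing events**: if `μ(𝒜 ∩ ℬ) μ(Ω) ≤ μ(𝒜) μ(ℬ)` for all increasing
events `𝒜`, `ℬ` depending on disjoint sets of coordinates, then `μ` is NA in the sense of Def. 2.7 (increasing
functions). [cite: BorceaBrandenLiggett2007, §2.1 Def. 2.7 and the layer cake `f = Σ a_i χ_{𝒜_i}`; §4.2 (proof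
sketch of Thm. 4.8); Pemantle2000, §2.2 Def. 2.1] -/
theorem isNegAssoc_of_events {μ : Finset σ → ℝ}
    (h : ∀ ⦃𝒜 ℬ : Finset (Finset σ)⦄, IsUpperSet (𝒜 : Set (Finset σ)) → IsUpperSet (ℬ : Set (Finset σ)) →
      ∀ ⦃E₁ E₂ : Finset σ⦄, DeterminedBy (setInd 𝒜) E₁ → DeterminedBy (setInd ℬ) E₂ → Disjoint E₁ E₂ →
        (∑ S ∈ 𝒜 ∩ ℬ, μ S) * mass μ ≤ (∑ S ∈ 𝒜, μ S) * ∑ S ∈ ℬ, μ S) :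
    IsNegAssoc μ := by
  intro F G hF hG E₁ E₂ hFE hGE hdisj
  refine ex_mul_mass_le_of_upperSets (fun ℬ hℬ hℬE => ?_) hG hGE
  rw [mul_comm F, mul_comm (ex μ F)]
  refine ex_mul_mass_le_of_upperSets (fun 𝒜 h𝒜 h𝒜E => ?_) hF hFE
  rw [setInd_mul, ex_setInd, ex_setInd, ex_setInd, Finset.inter_comm, mul_comm (∑ S ∈ ℬ, μ S)]
  exact h h𝒜 hℬ h𝒜E hℬE hdisj

/-- The easy direction: NA (Def. 2.7) gives the inequality for increasing events.
[cite: BorceaBrandenLiggett2007, §2.1 Def. 2.7; §4.2 Thm. 4.8] -/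
theorem IsNegAssoc.events {μ : Finset σ → ℝ} (h : IsNegAssoc μ) {𝒜 ℬ : Finset (Finset σ)}
    (h𝒜 : IsUpperSet (𝒜 : Set (Finset σ))) (hℬ : IsUpperSet (ℬ : Set (Finset σ))) {E₁ E₂ : Finset σ}
    (h𝒜E : DeterminedBy (setInd 𝒜) E₁) (hℬE : DeterminedBy (setInd ℬ) E₂) (hdisj : Disjoint E₁ E₂) :
    (∑ S ∈ 𝒜 ∩ ℬ, μ S) * mass μ ≤ (∑ S ∈ 𝒜, μ S) * ∑ S ∈ ℬ, μ S := by
  have key := h (monotone_setInd h𝒜) (monotone_setInd hℬ) h𝒜E hℬE hdisj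
  rwa [setInd_mul, ex_setInd, ex_setInd, ex_setInd] at key

/-- **NA (increasing functions) ⟺ NA (increasing events).** [cite: BorceaBrandenLiggett2007, §2.1 Def. 2.7,
§4.2 (proof sketch of Thm. 4.8); Pemantle2000, §2.2 Def. 2.1] -/
theorem isNegAssoc_iff_events (μ : Finset σ → ℝ) :
    IsNegAssoc μ ↔
      ∀ ⦃𝒜 ℬ : Finset (Finset σ)⦄, IsUpperSet (𝒜 : Set (Finset σ)) → IsUpperSet (ℬ : Set (Finset σ)) →
        ∀ ⦃E₁ E₂ : Finset σ⦄, DeterminedBy (setInd 𝒜) E₁ → DeterminedBy (setInd ℬ) E₂ → Disjoint E₁ E₂ →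
          (∑ S ∈ 𝒜 ∩ ℬ, μ S) * mass μ ≤ (∑ S ∈ 𝒜, μ S) * ∑ S ∈ ℬ, μ S :=
  ⟨fun h _ _ h𝒜 hℬ _ _ h𝒜E hℬE hdisj => h.events h𝒜 hℬ h𝒜E hℬE hdisj, isNegAssoc_of_events⟩

/-- **CNA is decided on increasing events** of the conditioned weights. [cite: BorceaBrandenLiggett2007, §2.1
Def. 2.7 (CNA); §4.2] -/
theorem isCNA_of_events {μ : Finset σ → ℝ}
    (h : ∀ I O : Finset σ, ∀ ⦃𝒜 ℬ : Finset (Finset σ)⦄, IsUpperSet (𝒜 : Set (Finset σ)) →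
      IsUpperSet (ℬ : Set (Finset σ)) → ∀ ⦃E₁ E₂ : Finset σ⦄, DeterminedBy (setInd 𝒜) E₁ →
        DeterminedBy (setInd ℬ) E₂ → Disjoint E₁ E₂ →
          (∑ S ∈ 𝒜 ∩ ℬ, pin I O μ S) * mass (pin I O μ) ≤ (∑ S ∈ 𝒜, pin I O μ S) * ∑ S ∈ ℬ, pin I O μ S) :
    IsCNA μ := fun I O => isNegAssoc_of_events (h I O)

/-- The Feder–Mihail class is NA in the sense of Def. 2.7, recovered from its event form (a consistency check of
the two formulations; the tree's `federMihail_negAssoc` is the function form). [cite: BorceaBrandenLiggett2007,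
§4.2 Thm. 4.8 and its proof sketch] -/
theorem IsFederMihail.isNegAssoc {μ : Finset σ → ℝ} (hμ : IsFederMihail μ) : IsNegAssoc μ :=
  isNegAssoc_of_events fun _ _ h𝒜 hℬ _ _ h𝒜E hℬE hdisj => federMihail_negAssoc_events hμ h𝒜 hℬ h𝒜E hℬE hdisj

end Events

end Literature.Probability.NegativeDependence

end
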